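import Summits.BirchSwinnertonDyer.BirchSwinnertonDyer.Theorems.TwoAdicConverseOrdLambdaHalfAtTwoOrdinaryLineRigidity
import Literature.NumberTheory.EllipticCurves.Kato2004.ZetaColemanMinusAtTwo
import Literature.NumberTheory.EllipticCurves.IwasawaAlgebraFiniteCokernelRigidityProofs
import HarnessLib

/-!
# Route `TwoAdicConverse` (rung S3), crux `OrdLambdaHalfAtTwo` (item stmt-BirchSwinnertonDyer-19556), line
# `kato_determinant_greenberg_two` (skeleton v4.7 `59b5c9c4a969`), stub 4‴ `ThetaShapiroKatoGreenbergSupplyAtTwo`: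
# the twist's first reciprocity law READ THROUGH W's Coleman map (`PinnedKatoCore.recA`) — Kato per curve + ordinary transport + rigidity

Cell `bsd-2adic`, seat `bsd-2adic-conv-1` GEN 31 (`--supports stmt-BirchSwinnertonDyer-19556 --as helper`).  The 4‴ datum's compact core
`TwoAdicKatoDeterminant.PinnedKatoCore` has ONE Coleman map `colMinus` on `𝐇¹_loc(T₂W) ⧸ H_f(W)` and TWO reciprocity laws through it (`recW` for
`E`, `recA` for the twist `E^K` entering via `𝐇¹(u_A)`).  Kato's printed package is PER CURVE (tree named fact p681779, option (a) of the pen's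
RC-362 (B) S1).  This file closes the gap: `exists_colemanMinus_recLaws` supplies `colMinus, colMinus_ker, colMinus_coker, zW, zA, nW, nA, unitW,
unitA, recW, recA` and the per-curve torsion / `λ`-index clauses, from the per-curve fact for `W` and for `A`, the ordinary transport along the
bijective local untwisting `u_A` (file `…OrdinaryLineRigidity`, named fact p698222), and the rigidity of finite-cokernel `Λ`-valued functionals
(two Coleman-type maps on one carrier differ by a unit, p697478).

HONEST FRAMING.  THEOREMS ONLY; no definition, no named fact minted, no `sorry`; CONDITIONAL on the named facts
`Kato2004.exists_zetaClass_colemanMinus_recLaw_index_two` (p681779) and `Kato2004.tateModuleFilAt_inertia_ordinary` (p698222); the crux is NOT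
proved here; BSD is not proved by any of this.  PARTITION (D-0054): none — RANK axis S3 × X5@2 stratum (β); closes none.
-/

set_option linter.dupNamespace false
set_option autoImplicit false

noncomputable section

open scoped NumberField
open Field IsDedekindDomain WeierstrassCurve CategoryTheory
open Literature.NumberTheory.GaloisRepresentations
open Literature.NumberTheory.EllipticCurves Literature.NumberTheory.EllipticCurves.Kato2004
open Literature.NumberTheory.EllipticCurves.Kato2004.EulerSystemValues

namespace Summit.BirchSwinnertonDyer.BirchSwinnertonDyer.Theorems.TwoAdicColemanTransport

open scoped MatrixGroups ModularForm
open CongruenceSubgroup Literature.NumberTheory.EllipticCurves.ModularForms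
open Summit.BirchSwinnertonDyer.BirchSwinnertonDyer.Theorems.TwoAdicOrdinaryLine

/-- **KATO'S PER-CURVE PACKAGE FOR `W` AND FOR THE TWIST `A`, READ ON `W`'S LOCAL CARRIER** (the Kato half of 4‴'s `PinnedKatoCore`).
For `W, A / ℚ` globally minimal, good ordinary at `2`, with newforms `f, g`, the cyclotomic data `(κ, γ)`, integral lifts `L₀, L₀'` of
`L₂(f, α)`, `L₂(g, α')`, the place `v ∋ 2` with a local generator lift, pins `I_W, I_A, J, J', J_A`, and a BIJECTIVE morphism
`u_A : T₂A|_v ⟶ T₂W|_v` of local Tate representations: there are ONE Coleman-type map `Col : 𝐇¹_loc(T₂W) ⧸ H_f(W) → Λ` (`2`-power-torsion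
kernel, finite cokernel), classes `z_W ∈ 𝐇¹_Γ(T₂W)`, `z_A ∈ 𝐇¹_Γ(T₂A)`, units and exponents with BOTH first reciprocity laws
`Col(loc z_W) = u_W·2^{n_W}·L₀` and `Col(𝐇¹(u_A) loc z_A) = u_A·2^{n_A}·L₀'`, both quotients `𝐇¹_Γ ⧸ Λz` torsion, and both `λ`-index identities.
PROOF: the named fact `exists_zetaClass_colemanMinus_recLaw_index_two` (p681779) for `W` on `(I_W, J, J')` and for `A` on `(I_A, J_A, J'_A)` (any
pin `J'_A` of `𝐇¹_loc(F⁺T₂A)`); the ordinary transport (`TwoAdicOrdinaryLine.exists_ordinary_transport`, from the named fact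
`tateModuleFilAt_inertia_ordinary` p698222) turns A's Coleman map into a second Coleman-type map `ψ` on `𝐇¹_loc(T₂W) ⧸ H_f(W)` with
`ψ(𝐇¹(u_A) loc z_A) = u'·2^{n'}·L₀'`; rigidity of finite-cokernel functionals (`IwasawaAlgebra.exists_unit_mul_C_pow_mul_eq_of_finite_cokernel`,
p697478) gives `Col = unit · ψ`.  CONDITIONAL on the two named facts. [cite: Kato2004Asterisque, Thm 12.5 (1)(2), Thm 16.6 (2), Prop 17.11, §17.13 p. 280]
[cite: GreenbergLNM1716, §2 (pp. 62–64)] -/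
theorem exists_colemanMinus_recLaws
    (hF3K : Kato2004.exists_zetaClass_colemanMinus_recLaw_index_two) (hOrd : Kato2004.tateModuleFilAt_inertia_ordinary)
    {W A : WeierstrassCurve ℚ} [W.IsElliptic] [W.IsGloballyMinimal] [A.IsElliptic] [A.IsGloballyMinimal]
    [ContinuousSMul ℤ_[2] (W.tateModule 2)] [ContinuousSMul ℤ_[2] (A.tateModule 2)]
    {N : ℕ} [NeZero N] (f : CuspForm (Gamma0 N) 2) (hf : IsNewformOf W f) (hordW : IsOrdinaryAt W 2)
    {N' : ℕ} [NeZero N'] (g : CuspForm (Gamma0 N') 2) (hg : IsNewformOf A g) (hordA : IsOrdinaryAt A 2)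
    (κ : ZpExtension ℚ 2) (γ : absoluteGaloisGroup ℚ) (hκ : κ.IsCyclotomic) (hγ : κ.IsTopGenerator γ)
    (hγ' : IsCyclotomicVariable 2 γ)
    (L₀ : IwasawaAlgebra 2) (hL₀ : iwasawaToPowerSeries 2 L₀ = padicLFunction f (unitRoot W 2 : ℚ_[2]))
    (L₀' : IwasawaAlgebra 2) (hL₀' : iwasawaToPowerSeries 2 L₀' = padicLFunction g (unitRoot A 2 : ℚ_[2]))
    (v : HeightOneSpectrum (𝓞 ℚ)) (hv : ((2 : ℕ) : 𝓞 ℚ) ∈ v.asIdeal)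
    (γᵥ : absoluteGaloisGroup (v.adicCompletion ℚ))
    (hsurj : Function.Surjective
      (κ.toContinuousMonoidHom.comp (resGalOfEmb (closureEmb (K := ℚ) (v.adicCompletion ℚ)))))
    (hγᵥ : κ.IsTopGenerator (resGalOfEmb (closureEmb (K := ℚ) (v.adicCompletion ℚ)) γᵥ))
    (I_W : IwasawaH1Data W 2 κ γ) (I_A : IwasawaH1Data A 2 κ γ)
    (J : LocalIwasawaH1Data κ v ((tateRep W 2).toLocal v) γᵥ)
    (J' : LocalIwasawaH1Data κ v (tateLocalOrdinaryRep W 2 v) γᵥ)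
    (J_A : LocalIwasawaH1Data κ v ((tateRep A 2).toLocal v) γᵥ)
    (uA : ((tateRep A 2).toLocal v).toTopRep ⟶ ((tateRep W 2).toLocal v).toTopRep) (hbij : Function.Bijective uA.hom) :
    ∃ (col : (J.H ⧸ LinearMap.range (J'.ordinaryInclusion J)) →ₗ[IwasawaAlgebra 2] IwasawaAlgebra 2)
      (zW : I_W.H) (zA : I_A.H) (uW uA' : (IwasawaAlgebra 2)ˣ) (nW nA : ℕ),
      (∀ q, col q = 0 → ∃ k : ℕ, (PowerSeries.C ((2 : ℤ_[2]) ^ k) : IwasawaAlgebra 2) • q = 0) ∧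
      Finite (IwasawaAlgebra 2 ⧸ LinearMap.range col) ∧
      col ((LinearMap.range (J'.ordinaryInclusion J)).mkQ (I_W.loc J hsurj hγ hγᵥ zW)) =
        (uW : IwasawaAlgebra 2) * PowerSeries.C ((2 : ℤ_[2]) ^ nW) * L₀ ∧
      col ((LinearMap.range (J'.ordinaryInclusion J)).mkQ (J_A.map uA J (I_A.loc J_A hsurj hγ hγᵥ zA))) =
        (uA' : IwasawaAlgebra 2) * PowerSeries.C ((2 : ℤ_[2]) ^ nA) * L₀' ∧
      Module.IsTorsion (IwasawaAlgebra 2) (I_W.H ⧸ Submodule.span (IwasawaAlgebra 2) {zW}) ∧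
      Module.IsTorsion (IwasawaAlgebra 2) (I_A.H ⧸ Submodule.span (IwasawaAlgebra 2) {zA}) ∧
      (∀ (D : W.SelmerDualData κ γ) (Y : W.FineSelmerDualData κ γ),
        Module.Finite (IwasawaAlgebra 2) D.X → Module.IsTorsion (IwasawaAlgebra 2) D.X →
        lambdaInvariant 2 (I_W.H ⧸ Submodule.span (IwasawaAlgebra 2) {zW}) + lambdaInvariant 2 D.X =
          lambdaInvariant 2 Y.X + lambdaInvariant 2 (IwasawaAlgebra 2 ⧸ Ideal.span ({L₀} : Set (IwasawaAlgebra 2)))) ∧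
      (∀ (D : A.SelmerDualData κ γ) (Y : A.FineSelmerDualData κ γ),
        Module.Finite (IwasawaAlgebra 2) D.X → Module.IsTorsion (IwasawaAlgebra 2) D.X →
        lambdaInvariant 2 (I_A.H ⧸ Submodule.span (IwasawaAlgebra 2) {zA}) + lambdaInvariant 2 D.X =
          lambdaInvariant 2 Y.X + lambdaInvariant 2 (IwasawaAlgebra 2 ⧸ Ideal.span ({L₀'} : Set (IwasawaAlgebra 2)))) := by
  -- a pin of `𝐇¹_loc(F⁺T₂A)`
  obtain ⟨J'_A⟩ := nonempty_localIwasawaH1Data κ v (tateLocalOrdinaryRep A 2 v) γᵥ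
  -- Kato per curve
  obtain ⟨z, col, u, n, hker, hcoker, hrec, htors, hindex⟩ :=
    hF3K W f hf hordW hordW.1 κ γ hκ hγ hγ' L₀ hL₀ v hv γᵥ hsurj hγᵥ I_W J J'
  obtain ⟨z', col', u', n', -, hcoker', hrec', htors', hindex'⟩ :=
    hF3K A g hg hordA hordA.1 κ γ hκ hγ hγ' L₀' hL₀' v hv γᵥ hsurj hγᵥ I_A J_A J'_A
  -- the ordinary transport
  obtain ⟨-, φinv, -, -, hleft, -, -, hHfinv⟩ :=
    exists_ordinary_transport hOrd hordW hordA hv uA hbij J J_A J' J'_A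
  have hle : LinearMap.range (J'.ordinaryInclusion J) ≤ (LinearMap.range (J'_A.ordinaryInclusion J_A)).comap φinv :=
    Submodule.map_le_iff_le_comap.mp hHfinv
  -- A's Coleman map read on W's carrier
  set ψ : (J.H ⧸ LinearMap.range (J'.ordinaryInclusion J)) →ₗ[IwasawaAlgebra 2] IwasawaAlgebra 2 :=
    col' ∘ₗ (LinearMap.range (J'.ordinaryInclusion J)).mapQ (LinearMap.range (J'_A.ordinaryInclusion J_A)) φinv hle with hψ
  have hψ_apply : ∀ y : J_A.H, ψ ((LinearMap.range (J'.ordinaryInclusion J)).mkQ (J_A.map uA J y)) =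
      col' ((LinearMap.range (J'_A.ordinaryInclusion J_A)).mkQ y) := fun y ↦ by
    simp only [hψ, LinearMap.comp_apply, Submodule.mkQ_apply, Submodule.mapQ_apply, hleft]
  have hψ_range : LinearMap.range ψ = LinearMap.range col' := by
    apply le_antisymm
    · rintro _ ⟨q, rfl⟩
      exact ⟨_, rfl⟩
    · rintro _ ⟨q, rfl⟩
      obtain ⟨y, rfl⟩ := (LinearMap.range (J'_A.ordinaryInclusion J_A)).mkQ_surjective q
      exact ⟨(LinearMap.range (J'.ordinaryInclusion J)).mkQ (J_A.map uA J y), hψ_apply y⟩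
  haveI : Finite (IwasawaAlgebra 2 ⧸ LinearMap.range col) := hcoker
  haveI : Finite (IwasawaAlgebra 2 ⧸ LinearMap.range ψ) := by rw [hψ_range]; exact hcoker'
  have hψz : ψ ((LinearMap.range (J'.ordinaryInclusion J)).mkQ (J_A.map uA J (I_A.loc J_A hsurj hγ hγᵥ z'))) =
      (u' : IwasawaAlgebra 2) * PowerSeries.C (((2 : ℕ) : ℤ_[2]) ^ n') * L₀' := by
    rw [hψ_apply]; exact hrec'
  obtain ⟨uu, huu⟩ := IwasawaAlgebra.exists_unit_mul_C_pow_mul_eq_of_finite_cokernel col ψ hker hψz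
  exact ⟨col, z, z', u, uu, n, n', hker, hcoker, hrec, huu, htors, htors', hindex, hindex'⟩

end Summit.BirchSwinnertonDyer.BirchSwinnertonDyer.Theorems.TwoAdicColemanTransport

end
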